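import Literature.NumberTheory.Automorphic.MeyerRatLogCoordinate
import Literature.NumberTheory.Automorphic.MeyerRatTheta
import Literature.NumberTheory.Automorphic.MeyerSummationSchwartz
import Literature.NumberTheory.Automorphic.MeyerHplusStructure
import Mathlib.Analysis.MellinTransform
import HarnessLib

/-!
# Meyer's global difference representation — proofs, `K = ℚ`: Mellin transforms of summation
# vectors, I (convergence, translates, pure tensors with invariant finite part)

Topic `NumberTheory/Automorphic`; namespace `Literature.NumberTheory.Automorphic.Meyer`. Sibling
PROOF file for the plan for `Meyer.spectralRealisation_rat` [Meyer2005, Thm. 5.11]: first half of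
the DIVISIBILITY theorem "the Fourier–Laplace transform of an unramified `Σ F`, `F ∈ 𝒮(𝔸_ℚ)`, is
`ζ(z)` times a function holomorphic on `Re z > 0`" — Meyer's Euler factorisation of the summation
map on unramified vectors, `Σ = ∏_p (1 - λ_p^{-1})^{-1}` [Meyer2005, Lemma 5.3, §5.2].

* `mellinConvergent_of_mem_weighted_Ioi` — for an unramified `f ∈ 𝒮(C_ℚ)_{>}` (Meyer's
  `𝒮(C)_{]1,∞[}`, where `Σ` lands by Lemma 5.3) the Mellin integral converges for `Re z > 1`;
* `meyerSum_comp_mul` — `Σ(F(· j)) (c) = ΣF(c [j])`; `comp_mul_mem_schwartzBruhatAdele`;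
* `ratTensor₂ g φ = g ⊗ φ` and **`meyerSum_ratTensor₂_posClass`** — for `φ` invariant under `Ẑˣ`
  with rational data `(N₁, M, a)` as produced by `MeyerRatFiniteInvariants`:
  `Σ(g ⊗ φ)[z(e^y)] = ∑_{m ≠ 0} g(m e^y / N₁) a(gcd(|m|, M))`;
* `tsum_int_gcd_eq_tsum_nat` — folding `m ↦ -m`:
  `= ∑_{n ≥ 1} a(gcd(n, M)) (g(n s) + g(-n s))`.

Everything is proved; the only definition is `ratTensor₂`.

## References

* R. Meyer, *On a representation of the idele class group related to primes and zeros of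
  L-functions*, Duke Math. J. 127 (2005) = arXiv:math/0311468, §5.2, Lemma 5.3 [Meyer2005].
-/

noncomputable section

open MeasureTheory Set Filter Complex NumberField IsDedekindDomain
open scoped Topology NNReal Classical

namespace Literature.NumberTheory.Automorphic.Meyer

/-! ### Mellin convergence on `𝒮(C_ℚ)_{>}` -/

section Convergence

variable {f : IdeleClassGroup ℚ → ℂ}

/-- Pointwise weighted bound for an unramified `f ∈ 𝒮(C_ℚ)_{>}`: `‖f[z(t)]‖ ≤ C t^{-α}` for every
`α > 1`. [cite: Meyer2005, Lemma 5.3] -/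
theorem norm_apply_posClass_log_le_of_mem_weighted
    (hunr : ∀ u ∈ integralFiniteUnits ℚ, ∀ x, f (x * finiteUnitClass ℚ u) = f x)
    (hf : f ∈ ideleClassSchwartzWeighted ℚ (Set.Ioi 1)) {α : ℝ} (hα : 1 < α) :
    ∃ C : ℝ, ∀ t : ℝ, 0 < t → ‖f (posClass (Real.log t))‖ ≤ C * t ^ (-α) := by
  have hw : weightMul ℚ α f ∈ ideleClassSchwartz ℚ := (mem_ideleClassSchwartzWeighted_iff.mp hf) α hα
  rw [mem_ideleClassSchwartz_iff, isIdeleClassSchwartz_iff_of_unramified (weightMul_isUnramified hunr)] at hw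
  obtain ⟨C, hC⟩ := hw.2 0 0
  refine ⟨C, fun t ht => ?_⟩
  have h := hC (Real.log t)
  rw [pow_zero, one_mul, norm_iteratedFDeriv_zero, weightMul_posClass, norm_mul, Complex.norm_real,
    Real.norm_eq_abs, Real.abs_exp, ← Real.log_rpow ht, Real.exp_log (Real.rpow_pos_of_pos ht α)] at h
  have htα : 0 < t ^ α := Real.rpow_pos_of_pos ht α
  rw [Real.rpow_neg ht.le, ← div_eq_mul_inv, le_div_iff₀ htα]
  exact h

/-- Continuity in the logarithmic coordinate for an unramified `f ∈ 𝒮(C_ℚ)_{>}`. [folklore] -/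
theorem continuous_apply_posClass_of_mem_weighted
    (hunr : ∀ u ∈ integralFiniteUnits ℚ, ∀ x, f (x * finiteUnitClass ℚ u) = f x)
    (hf : f ∈ ideleClassSchwartzWeighted ℚ (Set.Ioi 1)) : Continuous fun y : ℝ => f (posClass y) := by
  have hw : weightMul ℚ 2 f ∈ ideleClassSchwartz ℚ :=
    (mem_ideleClassSchwartzWeighted_iff.mp hf) 2 (by norm_num)
  rw [mem_ideleClassSchwartz_iff, isIdeleClassSchwartz_iff_of_unramified (weightMul_isUnramified hunr)] at hw
  have hc : Continuous fun y : ℝ => weightMul ℚ 2 f (posClass y) := hw.1.continuous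
  have heq : (fun y : ℝ => f (posClass y)) = fun y : ℝ => weightMul ℚ 2 f (posClass y) * (Real.exp (-(2 * y)) : ℂ) := by
    funext y
    rw [weightMul_posClass, mul_assoc, ← Complex.ofReal_mul, ← Real.exp_add, show 2 * y + -(2 * y) = 0 by ring,
      Real.exp_zero, Complex.ofReal_one, mul_one]
  rw [heq]
  exact hc.mul (by fun_prop)

/-- **The Mellin integral of an unramified `f ∈ 𝒮(C_ℚ)_{>}` converges for `Re z > 1`.**
[cite: Meyer2005, Lemma 5.3] -/
theorem mellinConvergent_of_mem_weighted_Ioi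
    (hunr : ∀ u ∈ integralFiniteUnits ℚ, ∀ x, f (x * finiteUnitClass ℚ u) = f x)
    (hf : f ∈ ideleClassSchwartzWeighted ℚ (Set.Ioi 1)) {z : ℂ} (hz : 1 < z.re) :
    MellinConvergent (fun t : ℝ => f (posClass (Real.log t))) z := by
  have hcont : ContinuousOn (fun t : ℝ => f (posClass (Real.log t))) (Ioi 0) :=
    (continuous_apply_posClass_of_mem_weighted hunr hf).comp_continuousOn
      (Real.continuousOn_log.mono fun _ ht => ne_of_gt ht)
  obtain ⟨C₁, h₁⟩ := norm_apply_posClass_log_le_of_mem_weighted hunr hf (α := z.re + 1) (by linarith)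
  obtain ⟨C₂, h₂⟩ := norm_apply_posClass_log_le_of_mem_weighted hunr hf (α := (1 + z.re) / 2) (by linarith)
  refine mellinConvergent_of_isBigO_rpow (a := z.re + 1) (b := (1 + z.re) / 2)
    (hcont.locallyIntegrableOn measurableSet_Ioi)
    (Asymptotics.IsBigO.of_bound C₁ ?_) (by linarith) (Asymptotics.IsBigO.of_bound C₂ ?_) (by linarith)
  · filter_upwards [eventually_gt_atTop (0 : ℝ)] with t ht
    rw [Real.norm_of_nonneg (Real.rpow_nonneg ht.le _)]
    exact h₁ t ht
  · filter_upwards [self_mem_nhdsWithin] with t ht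
    rw [Real.norm_of_nonneg (Real.rpow_nonneg (le_of_lt ht) _)]
    exact h₂ t ht

/-- The Mellin integral of an unramified `Σ F`, `F ∈ 𝒮(𝔸_ℚ)`, converges for `Re z > 1`.
[cite: Meyer2005, Lemma 5.3] -/
theorem mellinConvergent_meyerSum {F : AdeleRing (𝓞 ℚ) ℚ → ℂ} (hF : F ∈ schwartzBruhatAdele ℚ)
    (hunr : ∀ u ∈ integralFiniteUnits ℚ, ∀ x, meyerSum ℚ F (x * finiteUnitClass ℚ u) = meyerSum ℚ F x)
    {z : ℂ} (hz : 1 < z.re) :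
    MellinConvergent (fun t : ℝ => meyerSum ℚ F (posClass (Real.log t))) z :=
  mellinConvergent_of_mem_weighted_Ioi hunr (meyerSum_mem_ideleClassSchwartzWeighted_Ioi hF) hz

end Convergence

/-! ### Translates by finite ideles -/

section Translate

/-- `Σ(F(· j))(c) = ΣF(c · [j])` for a finite idele unit `j = (1, u)`. [cite: Meyer2005, §5.3] -/
theorem meyerSum_comp_mul_finIdele (F : AdeleRing (𝓞 ℚ) ℚ → ℂ) (u : (FiniteAdeleRing (𝓞 ℚ) ℚ)ˣ)
    (c : IdeleClassGroup ℚ) :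
    meyerSum ℚ (fun y => F (y * (finIdele ℚ u : AdeleRing (𝓞 ℚ) ℚ))) c = meyerSum ℚ F (c * finiteUnitClass ℚ u) := by
  induction c using QuotientGroup.induction_on with
  | H x =>
    rw [finiteUnitClass_eq, IdeleClassGroup.mk_apply, ← QuotientGroup.mk_mul, meyerSum_mk, meyerSum_mk]
    unfold ideleSum
    refine tsum_congr fun a => ?_
    simp only [Units.val_mul, mul_assoc]

/-- Translates of Bruhat–Schwartz functions by finite ideles are Bruhat–Schwartz. [cite: Meyer2005, §5.1] -/
theorem comp_mul_finIdele_mem_schwartzBruhatAdele {F : AdeleRing (𝓞 ℚ) ℚ → ℂ} (hF : F ∈ schwartzBruhatAdele ℚ)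
    (u : (FiniteAdeleRing (𝓞 ℚ) ℚ)ˣ) :
    (fun y => F (y * (finIdele ℚ u : AdeleRing (𝓞 ℚ) ℚ))) ∈ schwartzBruhatAdele ℚ := by
  have h := adeleDilation_mem_schwartzBruhatAdele hF (finIdele ℚ u)⁻¹
  have heq : adeleDilation ℚ (finIdele ℚ u)⁻¹ F = fun y => F (y * (finIdele ℚ u : AdeleRing (𝓞 ℚ) ℚ)) := by
    funext y
    rw [adeleDilation_apply, inv_inv, mul_comm]
  rwa [heq] at h

end Translate

/-! ### Pure tensors with invariant finite part -/

section Tensor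

/-- **The pure tensor `g ⊗ φ`** on `𝔸_ℚ = ℝ × 𝔸_ℚ^∞`. [cite: Meyer2005, §5.1] -/
def ratTensor₂ (g : ℝ → ℂ) (φ : FiniteAdeleRing (𝓞 ℚ) ℚ → ℂ) : AdeleRing (𝓞 ℚ) ℚ → ℂ := fun x =>
  g (mixedSpaceEquivReal (InfiniteAdeleRing.ringEquiv_mixedSpace ℚ x.1)) * φ x.2

/-- Unfolding of `ratTensor₂`. [folklore] -/
theorem ratTensor₂_apply (g : ℝ → ℂ) (φ : FiniteAdeleRing (𝓞 ℚ) ℚ → ℂ) (x : AdeleRing (𝓞 ℚ) ℚ) :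
    ratTensor₂ g φ x = g (mixedSpaceEquivReal (InfiniteAdeleRing.ringEquiv_mixedSpace ℚ x.1)) * φ x.2 := rfl

/-- `g ⊗ φ ∈ 𝒮(𝔸_ℚ)` for `g` Schwartz and `φ` Schwartz–Bruhat. [cite: Meyer2005, §5.1] -/
theorem ratTensor₂_mem_schwartzBruhatAdele (g : SchwartzMap ℝ ℂ) {φ : FiniteAdeleRing (𝓞 ℚ) ℚ → ℂ}
    (hφ : φ ∈ SchwartzBruhat (FiniteAdeleRing (𝓞 ℚ) ℚ)) : ratTensor₂ g φ ∈ schwartzBruhatAdele ℚ := by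
  have h := tensor_mem_schwartzBruhatAdele (K := ℚ) (SchwartzMap.compCLMOfContinuousLinearEquiv ℂ mixedSpaceEquivReal g) hφ
  convert h using 2 with x
  rw [ratTensor₂_apply, SchwartzMap.compCLMOfContinuousLinearEquiv_apply, Function.comp_apply]

/-- `g ⊗ φ` is `(1, u)`-invariant for `u ∈ Ẑˣ` when `φ` is. [cite: Meyer2005, §5.2] -/
theorem ratTensor₂_mul_finIdele (g : ℝ → ℂ) {φ : FiniteAdeleRing (𝓞 ℚ) ℚ → ℂ}
    (hinv : ∀ u ∈ integralFiniteUnits ℚ, ∀ x, φ ((u : FiniteAdeleRing (𝓞 ℚ) ℚ) * x) = φ x)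
    {u : (FiniteAdeleRing (𝓞 ℚ) ℚ)ˣ} (hu : u ∈ integralFiniteUnits ℚ) (y : AdeleRing (𝓞 ℚ) ℚ) :
    ratTensor₂ g φ (y * (finIdele ℚ u : AdeleRing (𝓞 ℚ) ℚ)) = ratTensor₂ g φ y := by
  rw [mul_finIdele_eq, ratTensor₂_apply, ratTensor₂_apply]
  congr 1
  rw [mul_comm]
  exact hinv u hu _

/-- `Σ(g ⊗ φ)` is unramified when `φ` is `Ẑˣ`-invariant. [cite: Meyer2005, §5.2] -/
theorem meyerSum_ratTensor₂_unramified (g : ℝ → ℂ) {φ : FiniteAdeleRing (𝓞 ℚ) ℚ → ℂ}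
    (hinv : ∀ u ∈ integralFiniteUnits ℚ, ∀ x, φ ((u : FiniteAdeleRing (𝓞 ℚ) ℚ) * x) = φ x) :
    ∀ u ∈ integralFiniteUnits ℚ, ∀ c, meyerSum ℚ (ratTensor₂ g φ) (c * finiteUnitClass ℚ u) = meyerSum ℚ (ratTensor₂ g φ) c := by
  intro u hu c
  rw [← meyerSum_comp_mul_finIdele]
  congr 1
  funext y
  exact ratTensor₂_mul_finIdele g hinv hu y

/-- The value of `g ⊗ φ` at `a · z(t)` (`a ∈ ℚˣ`, `t > 0`): `g(a t) φ(a)`. [cite: Meyer2005, §5.2] -/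
theorem ratTensor₂_algebraMap_mul_posRealIdele (g : ℝ → ℂ) (φ : FiniteAdeleRing (𝓞 ℚ) ℚ → ℂ) (t : ℝ≥0ˣ) (a : ℚˣ) :
    ratTensor₂ g φ (algebraMap ℚ (AdeleRing (𝓞 ℚ) ℚ) (a : ℚ) * ((posRealIdele ℚ t : GaloisRepresentations.ideleGroup ℚ) : AdeleRing (𝓞 ℚ) ℚ)) =
      g ((a : ℚ) * ((t : ℝ≥0) : ℝ)) * φ (algebraMap ℚ (FiniteAdeleRing (𝓞 ℚ) ℚ) (a : ℚ)) := by
  rw [ratTensor₂_apply]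
  have harch : mixedSpaceEquivReal (InfiniteAdeleRing.ringEquiv_mixedSpace ℚ
      (algebraMap ℚ (AdeleRing (𝓞 ℚ) ℚ) (a : ℚ) * ((posRealIdele ℚ t : GaloisRepresentations.ideleGroup ℚ) : AdeleRing (𝓞 ℚ) ℚ)).1) =
      (a : ℚ) * ((t : ℝ≥0) : ℝ) := by
    rw [show (algebraMap ℚ (AdeleRing (𝓞 ℚ) ℚ) (a : ℚ) *
        ((posRealIdele ℚ t : GaloisRepresentations.ideleGroup ℚ) : AdeleRing (𝓞 ℚ) ℚ)).1 =
        algebraMap ℚ (InfiniteAdeleRing ℚ) (a : ℚ) * ((posRealIdele ℚ t : GaloisRepresentations.ideleGroup ℚ) : AdeleRing (𝓞 ℚ) ℚ).1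
        from rfl, mixedSpaceEquivReal_ringEquiv_mul, mixedSpaceEquivReal_ringEquiv_algebraMap, posRealIdele_fst,
      mixedSpaceEquivReal_ringEquiv_realToInfiniteAdele]
  have hfin : (algebraMap ℚ (AdeleRing (𝓞 ℚ) ℚ) (a : ℚ) *
      ((posRealIdele ℚ t : GaloisRepresentations.ideleGroup ℚ) : AdeleRing (𝓞 ℚ) ℚ)).2 = algebraMap ℚ (FiniteAdeleRing (𝓞 ℚ) ℚ) (a : ℚ) := by
    rw [show (algebraMap ℚ (AdeleRing (𝓞 ℚ) ℚ) (a : ℚ) *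
        ((posRealIdele ℚ t : GaloisRepresentations.ideleGroup ℚ) : AdeleRing (𝓞 ℚ) ℚ)).2 =
        algebraMap ℚ (FiniteAdeleRing (𝓞 ℚ) ℚ) (a : ℚ) * ((posRealIdele ℚ t : GaloisRepresentations.ideleGroup ℚ) : AdeleRing (𝓞 ℚ) ℚ).2
        from rfl, posRealIdele_snd, mul_one]
  rw [harch, hfin]

/-- **`Σ(g ⊗ φ)(z(t)) = ∑_{m ≠ 0} g(m t / N₁) a(gcd(|m|, M))`** when the values of `φ` on `ℚ` are
governed by the rational data `(N₁, M, a)` (as for a `Ẑˣ`-invariant `φ`, `MeyerRatFiniteInvariants`):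
in the sum over `a ∈ ℚˣ` exactly the `a = m / N₁`, `m ≠ 0`, contribute. [cite: Meyer2005, §5.2] -/
theorem ideleSum_ratTensor₂ (g : ℝ → ℂ) {φ : FiniteAdeleRing (𝓞 ℚ) ℚ → ℂ} {N₁ M : ℕ} (hN₁ : N₁ ≠ 0)
    {a : ℕ → ℂ} (hsupp : ∀ q : ℚ, φ (algebraMap ℚ (FiniteAdeleRing (𝓞 ℚ) ℚ) q) ≠ 0 → ∃ m : ℤ, q = m / N₁)
    (hval : ∀ m : ℤ, m ≠ 0 → φ (algebraMap ℚ (FiniteAdeleRing (𝓞 ℚ) ℚ) ((m : ℚ) / N₁)) = a (Int.gcd m M))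
    (t : ℝ≥0ˣ) :
    ideleSum ℚ (ratTensor₂ g φ) (posRealIdele ℚ t) =
      ∑' m : ℤ, if m = 0 then 0 else g ((m : ℝ) / N₁ * ((t : ℝ≥0) : ℝ)) * a (Int.gcd m M) := by
  have hN₁q : (N₁ : ℚ) ≠ 0 := by exact_mod_cast hN₁
  unfold ideleSum
  simp_rw [ratTensor₂_algebraMap_mul_posRealIdele g φ t]
  -- reindex the sum over `ℚˣ` along the non-zero integers, `m ↦ m / N₁`
  set j : ({n : ℤ | n ≠ 0} : Set ℤ) → ℚˣ := fun n => Units.mk0 (((n : ℤ) : ℚ) / N₁)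
    (div_ne_zero (by exact_mod_cast (Set.mem_setOf.mp n.2)) hN₁q) with hj
  have hjinj : Function.Injective j := by
    intro m n h
    have h' : (((m : ℤ) : ℚ) / N₁) = (((n : ℤ) : ℚ) / N₁) := by
      have := congrArg (fun q : ℚˣ => (q : ℚ)) h
      simpa only [hj, Units.val_mk0] using this
    have h'' : ((m : ℤ) : ℚ) = ((n : ℤ) : ℚ) := by
      have := congrArg (fun q : ℚ => q * N₁) h'
      simpa only [div_mul_cancel₀ _ hN₁q] using this
    exact Subtype.ext (by exact_mod_cast h'')
  have hsupp' : Function.support (fun b : ℚˣ => g ((b : ℚ) * ((t : ℝ≥0) : ℝ)) *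
      φ (algebraMap ℚ (FiniteAdeleRing (𝓞 ℚ) ℚ) (b : ℚ))) ⊆ Set.range j := by
    intro b hb
    rw [Function.mem_support] at hb
    have hφ : φ (algebraMap ℚ (FiniteAdeleRing (𝓞 ℚ) ℚ) (b : ℚ)) ≠ 0 := fun h => hb (by rw [h, mul_zero])
    obtain ⟨m, hm⟩ := hsupp _ hφ
    have hm0 : m ≠ 0 := by
      rintro rfl
      exact b.ne_zero (by rw [hm, Int.cast_zero, zero_div])
    exact ⟨⟨m, Set.mem_setOf.mpr hm0⟩, Units.ext (by simp [hj, hm])⟩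
  rw [← hjinj.tsum_eq hsupp']
  have hterm : ∀ n : ({n : ℤ | n ≠ 0} : Set ℤ),
      g (((j n : ℚˣ) : ℚ) * ((t : ℝ≥0) : ℝ)) * φ (algebraMap ℚ (FiniteAdeleRing (𝓞 ℚ) ℚ) ((j n : ℚˣ) : ℚ)) =
        g (((n : ℤ) : ℝ) / N₁ * ((t : ℝ≥0) : ℝ)) * a (Int.gcd (n : ℤ) M) := by
    intro n
    simp only [hj, Units.val_mk0]
    rw [hval _ (Set.mem_setOf.mp n.2)]
    push_cast
    rfl
  simp_rw [hterm]
  rw [tsum_subtype {n : ℤ | n ≠ 0} (fun n : ℤ => g ((n : ℝ) / N₁ * ((t : ℝ≥0) : ℝ)) * a (Int.gcd n M))]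
  refine tsum_congr fun n => ?_
  by_cases hn : n = 0
  · rw [if_pos hn, Set.indicator_of_notMem (by simpa using hn)]
  · rw [if_neg hn, Set.indicator_of_mem (by simpa using hn)]

/-- **`Σ(g ⊗ φ)` in the logarithmic coordinate**: `Σ(g ⊗ φ)[z(e^y)] = ∑_{m ≠ 0} g(m e^y / N₁) a(gcd(|m|, M))`.
[cite: Meyer2005, §5.2] -/
theorem meyerSum_ratTensor₂_posClass (g : ℝ → ℂ) {φ : FiniteAdeleRing (𝓞 ℚ) ℚ → ℂ} {N₁ M : ℕ} (hN₁ : N₁ ≠ 0)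
    {a : ℕ → ℂ} (hsupp : ∀ q : ℚ, φ (algebraMap ℚ (FiniteAdeleRing (𝓞 ℚ) ℚ) q) ≠ 0 → ∃ m : ℤ, q = m / N₁)
    (hval : ∀ m : ℤ, m ≠ 0 → φ (algebraMap ℚ (FiniteAdeleRing (𝓞 ℚ) ℚ) ((m : ℚ) / N₁)) = a (Int.gcd m M))
    (y : ℝ) :
    meyerSum ℚ (ratTensor₂ g φ) (posClass y) =
      ∑' m : ℤ, if m = 0 then 0 else g ((m : ℝ) / N₁ * Real.exp y) * a (Int.gcd m M) := by
  rw [posClass, IdeleClassGroup.mk_apply, meyerSum_mk, ideleSum_ratTensor₂ g hN₁ hsupp hval]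
  rfl

/-- **Folding `m ↦ -m`**: `∑_{m ≠ 0} g(m s) a(gcd(|m|, M)) = ∑_{n ≥ 1} a(gcd(n, M)) (g(ns) + g(-ns))`, when
both halves converge. [folklore] -/
theorem tsum_int_gcd_eq_tsum_nat (g : ℝ → ℂ) (a : ℕ → ℂ) (M : ℕ) (s : ℝ)
    (h₁ : Summable fun n : ℕ => g (((n + 1 : ℕ) : ℝ) * s) * a (Nat.gcd (n + 1) M))
    (h₂ : Summable fun n : ℕ => g (-(((n + 1 : ℕ) : ℝ) * s)) * a (Nat.gcd (n + 1) M)) :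
    (∑' m : ℤ, if m = 0 then (0 : ℂ) else g ((m : ℝ) * s) * a (Int.gcd m M)) =
      ∑' n : ℕ, a (Nat.gcd (n + 1) M) * (g (((n + 1 : ℕ) : ℝ) * s) + g (-(((n + 1 : ℕ) : ℝ) * s))) := by
  set f : ℤ → ℂ := fun m => if m = 0 then (0 : ℂ) else g ((m : ℝ) * s) * a (Int.gcd m M) with hf
  have hnat : ∀ n : ℕ, f ((n : ℤ) + 1) = g (((n + 1 : ℕ) : ℝ) * s) * a (Nat.gcd (n + 1) M) := by
    intro n
    rw [hf]
    simp only
    rw [if_neg (by omega), show ((n : ℤ) + 1) = ((n + 1 : ℕ) : ℤ) by push_cast; ring, Int.gcd_natCast_natCast]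
    push_cast
    ring_nf
  have hneg : ∀ n : ℕ, f (-((n : ℤ) + 1)) = g (-(((n + 1 : ℕ) : ℝ) * s)) * a (Nat.gcd (n + 1) M) := by
    intro n
    rw [hf]
    simp only
    rw [if_neg (by omega), Int.neg_gcd, show ((n : ℤ) + 1) = ((n + 1 : ℕ) : ℤ) by push_cast; ring,
      Int.gcd_natCast_natCast]
    push_cast
    ring_nf
  have hf0 : f 0 = 0 := by rw [hf]; simp
  have H₁ : HasSum (fun n : ℕ => f ((n : ℤ) + 1)) (∑' n : ℕ, g (((n + 1 : ℕ) : ℝ) * s) * a (Nat.gcd (n + 1) M)) := by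
    simp_rw [hnat]; exact h₁.hasSum
  have H₂ : HasSum (fun n : ℕ => f (-((n : ℤ) + 1))) (∑' n : ℕ, g (-(((n + 1 : ℕ) : ℝ) * s)) * a (Nat.gcd (n + 1) M)) := by
    simp_rw [hneg]; exact h₂.hasSum
  have H := HasSum.of_add_one_of_neg_add_one H₁ H₂
  rw [hf0, add_zero] at H
  rw [H.tsum_eq, ← h₁.tsum_add h₂]
  refine tsum_congr fun n => ?_
  ring

end Tensor

end Literature.NumberTheory.Automorphic.Meyer
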